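import Summits.CriticalPhenomena.CardyFormulaZ2.Theorems.CardyBoundaryCoulombGasBoundaryDefectGaussianRStubRealisabilityPart20
import Summits.CriticalPhenomena.CardyFormulaZ2.Theorems.CardyBoundaryCoulombGasBoundaryDefectGaussianRStubRealisabilityPart8

/-!
# Stub `stub_realisability` of line `rainbow-monomials-in-excursion-kernels` — Part 21:
# strand ends of the collar walk (II): footprints of an admissible flat insertion, active darts
# are rail darts, the two phases of the level profile
# (crux `BoundaryDefectGaussianR`, stmt-CriticalPhenomena-14132; insertion dictionary D2, layer 3b)

Notation as in Parts 7/8: `ι` admissible on `V`, `outDart V ι.sink = some d₀`, `ds = cycle V d₀`,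
`P = ds.length`, `L = ι.sinkLegs`, `st t` the walk state after `t` darts (hypothesis `hst`), and
the FLATNESS clause of the crux stubs with radius `L + 3` at every insertion point.

* the cycle: `ds[t] = dsucc^[t] d₀`, all darts exterior, no duplicates, `dsucc ds[P-1] = d₀`
  (`se_cycle_getElem`, `se_cycle_exterior`, `se_cycle_index_inj`, `se_dsucc_last`, from
  `s3_cycle_orbit` / `s3_period_spec`);
* insertion points: frame chart at every insertion point (`se_chart_of_mem`); start darts are the
  exterior darts of insertion points, `1 ≤ L' ≤ L`, sink `σ = +1` / sources `σ = -1`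
  (`se_startAt_some`, `se_startAt_sgn_neg`);
* **footprints**: after `t` darts either nothing is pending or an insertion started `s < t` darts
  ago with `pending + (t - s) ≤ L` (`se_footprint_invariant`); hence a dart where the level
  changes (an ACTIVE dart) lies at most `L - 1` darts after a start (`se_active_footprint`);
* **runs**: the `L - 1` darts after the exterior dart of a flat insertion point are the rail darts
  `(x + j • dir (K+1), K)` and the dart before it is `(x - dir (K+1), K)` (`se_run`, `tp_walk_run`);
* **active darts are rail darts** (`se_active_rail`): `ds[t] = (c, K)` with radius-`2` charts at
  `c` and at `c - dir (K+1)`, and the cyclically previous dart is `(c - dir (K+1), K)`;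
* **the two phases** (`se_phases`): an index `1 ≤ T₀ ≤ P` (end of the sink's footprint) with
  level `0`, the level increasing strictly at every dart before `T₀` (sink legs, sign `+1`) and
  non-increasing afterwards (sources, sign `-1`).

Registered one-line form: `s14_strandEnds_activeRail`. All [folklore].
-/

namespace Summit.CriticalPhenomena.CardyFormulaZ2.Cruxes.BoundaryDefectGaussianR.RainbowMonomialsInExcursionKernels

open Literature.Probability.LatticeModels Literature.Probability.LatticeModels.CollarLegModel

section Admissible

variable (ι : LegInsertionData) (V : Finset (ℤ × ℤ)) {d₀ : Dart} (hadm : ι.IsAdmissible V)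
  (h : outDart V ι.sink = some d₀) {st : ℕ → WalkState}
  (hst : ∀ t, st t = List.foldl (fun s d => s.step (ι.startAt V d)) ι.init ((cycle V d₀).take t))

/-! ### The boundary cycle: indexing, exterior darts, no duplicates -/

/-- The `t`-th dart of the cycle is the `t`-th iterate of the boundary successor. [folklore] -/
theorem se_cycle_getElem {t : ℕ} (ht : t < (cycle V d₀).length) : (cycle V d₀)[t] = (dsucc V)^[t] d₀ := by
  simp [cycle]

include hadm h in
/-- Every dart of the cycle is exterior. [folklore] -/
theorem se_cycle_exterior {t : ℕ} (ht : t < (cycle V d₀).length) :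
    ((cycle V d₀)[t]).1 ∈ V ∧ dartTip (cycle V d₀)[t] ∉ V := by
  rw [se_cycle_getElem V ht]
  obtain ⟨hv, htip⟩ := sinkDart_exterior ι V hadm h
  exact (s3_dsucc_iterate V t).1 d₀ hv htip

include hadm h in
/-- The cycle has no duplicates: equal darts have equal indices. [folklore] -/
theorem se_cycle_index_inj {t t' : ℕ} (ht : t < (cycle V d₀).length) (ht' : t' < (cycle V d₀).length)
    (he : (cycle V d₀)[t] = (cycle V d₀)[t']) : t = t' := by
  obtain ⟨hv, htip⟩ := sinkDart_exterior ι V hadm h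
  exact ((s3_cycle_orbit V d₀ hv htip).2.2.2.1.getElem_inj_iff).1 he

include hadm h in
/-- The successor of the last dart of the cycle is the sink's dart (dart `0`). [folklore] -/
theorem se_dsucc_last : dsucc V ((cycle V d₀)[(cycle V d₀).length - 1]'(by
      have := length_cycle_pos ι V hadm h; omega)) = d₀ := by
  obtain ⟨hv, htip⟩ := sinkDart_exterior ι V hadm h
  have hP := length_cycle_pos ι V hadm h
  rw [se_cycle_getElem V (by omega), ← Function.iterate_succ_apply' (dsucc V), Nat.succ_eq_add_one,
    Nat.sub_add_cancel hP]
  simpa [cycle] using (s3_period_spec V d₀ hv htip).2.2.1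

/-! ### Insertion points: charts and start darts -/

include hadm in
/-- **Chart at an insertion point.** Under the flatness clause, every insertion point `x` has an
exterior dart `(x, K)` = `outDart V x` and the frame chart of `se_chart_of_flat`. [folklore] -/
theorem se_chart_of_mem
    (hflat : ∀ x ∈ insert ι.sink ι.source, ∃ d : ℤ × ℤ, (d = (1, 0) ∨ d = (-1, 0) ∨ d = (0, 1) ∨ d = (0, -1)) ∧
      ∀ v : ℤ × ℤ, (v.1 - x.1) ^ 2 + (v.2 - x.2) ^ 2 ≤ ((ι.sinkLegs : ℤ) + 3) ^ 2 →
        (v ∈ V ↔ 0 ≤ (v.1 - x.1) * d.1 + (v.2 - x.2) * d.2))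
    {x : ℤ × ℤ} (hx : x ∈ insert ι.sink ι.source) :
    ∃ K : Fin 4, outDart V x = some (x, K) ∧
      ∀ s t : ℤ, -3 ≤ s → s ≤ (ι.sinkLegs : ℤ) + 1 → -2 ≤ t → t ≤ 2 →
        (x + s • dir (K + 1) + t • dir K ∈ V ↔ t ≤ 0) := by
  obtain ⟨-, hcard, -⟩ := hadm.2.2.2.1 x hx
  obtain ⟨K, hout, hK, -⟩ := s3_outDart_of_card V x hcard
  obtain ⟨d, hd, hfl⟩ := hflat x hx
  exact ⟨K, hout, se_chart_of_flat V x K ι.sinkLegs (sinkLegs_pos ι V hadm) hK hd hfl⟩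

include hadm h in
/-- **Start darts.** If an insertion `(L', σ)` starts at the dart `d`, then `d.1` is an insertion
point with `outDart V d.1 = d`, `1 ≤ L' ≤ L`, and either `d` is the sink's dart (`σ = +1`) or
`d.1` is a source (`σ = -1`). [folklore] -/
theorem se_startAt_some {d : Dart} {L' : ℕ} {σ : ℤ} (hs : ι.startAt V d = some (L', σ)) :
    d.1 ∈ insert ι.sink ι.source ∧ outDart V d.1 = some d ∧ 1 ≤ L' ∧ L' ≤ ι.sinkLegs ∧
      (σ = 1 ∧ d = d₀ ∨ σ = -1 ∧ d.1 ∈ ι.source) := by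
  unfold LegInsertionData.startAt at hs
  split_ifs at hs with h1 h2
  · simp only [Option.some.injEq, Prod.mk.injEq] at hs
    obtain ⟨rfl, rfl⟩ := hs
    have hd : d = d₀ := Option.some.inj (h1.symm.trans h)
    have h0 : d.1 = ι.sink := (s3_outDart_some V ι.sink d h1).1
    refine ⟨h0 ▸ Finset.mem_insert_self _ _, h0 ▸ h1, sinkLegs_pos ι V hadm, le_rfl, Or.inl ⟨rfl, hd⟩⟩
  · simp only [Option.some.injEq, Prod.mk.injEq] at hs
    obtain ⟨rfl, rfl⟩ := hs
    refine ⟨Finset.mem_insert_of_mem h2.1, h2.2, hadm.2.1 _ h2.1,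
      Finset.single_le_sum (fun _ _ => Nat.zero_le _) h2.1, Or.inr ⟨rfl, h2.1⟩⟩

include hst in
/-- **Footprint invariant.** After `t` darts either nothing is pending, or an insertion started at
an earlier dart `s` and the pending legs plus the darts walked since `s` number at most `L`
(so a footprint occupies at most `L` consecutive darts). [folklore] -/
theorem se_footprint_invariant : ∀ {t : ℕ} (_ : t ≤ (cycle V d₀).length), ι.IsAdmissible V →
    (st t).pending = 0 ∨ ∃ (s : ℕ) (_ : s < t), ι.startAt V ((cycle V d₀)[s]'(by omega)) ≠ none ∧
      (st t).pending + (t - s) ≤ ι.sinkLegs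
  | 0, _, _ => Or.inl (by rw [hst]; rfl)
  | t + 1, ht, hadm => by
    have ih := se_footprint_invariant (t := t) (by omega) hadm
    rw [st_succ ι V hst (t := t) (by omega)]
    rcases hso : ι.startAt V (cycle V d₀)[t] with _ | ⟨L', σ⟩
    · by_cases h0 : (st t).pending = 0
      · left; rw [step_none_of_pending _ h0]; exact h0
      · rcases ih with h0' | ⟨s, hs, hne, hle⟩
        · exact absurd h0' h0
        · right
          refine ⟨s, by omega, hne, ?_⟩
          have := pending_step_none_le (st t)
          omega
    · right
      refine ⟨t, by omega, Option.ne_none_iff_exists'.2 ⟨_, hso⟩, ?_⟩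
      have h1 := pending_step_some_le (st t) L' σ
      have h2 : L' ≤ ι.sinkLegs := by
        unfold LegInsertionData.startAt at hso
        split_ifs at hso with h1 h2
        · simp only [Option.some.injEq, Prod.mk.injEq] at hso; omega
        · simp only [Option.some.injEq, Prod.mk.injEq] at hso
          rw [← hso.1]
          exact Finset.single_le_sum (fun _ _ => Nat.zero_le _) h2.1
      have hL := sinkLegs_pos ι V hadm
      omega

include hadm hst in
/-- **Active darts lie in footprints.** If the level changes at dart `t`, an insertion started at a
dart `s ≤ t` at most `L - 1` darts earlier. [folklore] -/
theorem se_active_footprint {t : ℕ} (ht : t < (cycle V d₀).length)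
    (hact : (st (t + 1)).level ≠ (st t).level) :
    ∃ (s : ℕ) (_ : s ≤ t), t - s ≤ ι.sinkLegs - 1 ∧ ι.startAt V ((cycle V d₀)[s]'(by omega)) ≠ none := by
  rw [st_succ ι V hst ht] at hact
  rcases hso : ι.startAt V (cycle V d₀)[t] with _ | ⟨L', σ⟩
  · rw [hso] at hact
    have hp : (st t).pending ≠ 0 := fun h0 => hact (by rw [step_none_of_pending _ h0])
    rcases se_footprint_invariant ι V hst ht.le hadm with h0 | ⟨s, hs, hne, hle⟩
    · exact absurd h0 hp
    · have hp1 : 1 ≤ (st t).pending := Nat.one_le_iff_ne_zero.2 hp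
      exact ⟨s, hs.le, by omega, hne⟩
  · exact ⟨t, le_rfl, by simp, Option.ne_none_iff_exists'.2 ⟨_, hso⟩⟩

/-! ### Runs along a flat rail -/

include hadm h in
/-- **The run through a flat insertion point.** If dart `s` of the cycle is the exterior dart
`(x, K)` of a point with the frame chart of radius `L + 1`, then the next `L - 1` darts (as long as
the cycle lasts) are the rail darts `(x + j • dir (K+1), K)`, and the dart before `s` (cyclically)
is `(x - dir (K+1), K)`. [folklore] -/
theorem se_run {x : ℤ × ℤ} {K : Fin 4}
    (hch : ∀ s t : ℤ, -3 ≤ s → s ≤ (ι.sinkLegs : ℤ) + 1 → -2 ≤ t → t ≤ 2 →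
      (x + s • dir (K + 1) + t • dir K ∈ V ↔ t ≤ 0))
    {s : ℕ} (hs : s < (cycle V d₀).length) (hds : (cycle V d₀)[s] = (x, K)) :
    (∀ j : ℕ, j ≤ ι.sinkLegs - 1 → ∀ (hj : s + j < (cycle V d₀).length),
      (cycle V d₀)[s + j] = (x + (j : ℤ) • dir (K + 1), K)) ∧
    (∀ (h1 : 1 ≤ s), (cycle V d₀)[s - 1] = (x - dir (K + 1), K)) ∧
    (s = 0 → (cycle V d₀)[(cycle V d₀).length - 1]'(by omega) = (x - dir (K + 1), K)) := by
  have hL := sinkLegs_pos ι V hadm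
  have hrail : ∀ i : ℕ, i < ι.sinkLegs - 1 → x + ((i : ℤ) + 1) • dir (K + 1) ∈ V ∧
      x + ((i : ℤ) + 1) • dir (K + 1) + dir K ∉ V := by
    intro i hi
    have hi' : (i : ℤ) + 1 ≤ (ι.sinkLegs : ℤ) + 1 := by
      have : (i : ℤ) < (ι.sinkLegs : ℤ) := by exact_mod_cast (by omega : i < ι.sinkLegs)
      omega
    constructor
    · have e : x + ((i : ℤ) + 1) • dir (K + 1) = x + ((i : ℤ) + 1) • dir (K + 1) + (0 : ℤ) • dir K := by module
      rw [e]; exact (hch _ _ (by omega) hi' (by norm_num) (by norm_num)).2 le_rfl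
    · have e : x + ((i : ℤ) + 1) • dir (K + 1) + dir K = x + ((i : ℤ) + 1) • dir (K + 1) + (1 : ℤ) • dir K := by module
      rw [e]; intro hm
      have := (hch _ _ (by omega) hi' (by norm_num) (by norm_num)).1 hm
      omega
  have hloc : ∀ s t : ℤ, -2 ≤ s → s ≤ 2 → -2 ≤ t → t ≤ 2 →
      (x + s • dir (K + 1) + t • dir K ∈ V ↔ t ≤ 0) :=
    fun s t hs1 hs2 ht1 ht2 => hch s t (by omega) (by omega) ht1 ht2
  obtain ⟨hxV, hxK, -, -, -, hpred⟩ := se_rail_local hloc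
  -- the predecessor dart is exterior
  have hpV : (x - dir (K + 1), K).1 ∈ V ∧ dartTip (x - dir (K + 1), K) ∉ V := by
    have e1 : x - dir (K + 1) = x + (-1 : ℤ) • dir (K + 1) + (0 : ℤ) • dir K := by module
    have e2 : x - dir (K + 1) + dir K = x + (-1 : ℤ) • dir (K + 1) + (1 : ℤ) • dir K := by module
    refine ⟨?_, ?_⟩
    · show x - dir (K + 1) ∈ V
      rw [e1]; exact (hch _ _ (by norm_num) (by omega) (by norm_num) (by norm_num)).2 le_rfl
    · show x - dir (K + 1) + dir K ∉ V
      rw [e2]; intro hm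
      have := (hch _ _ (by norm_num) (by omega) (by norm_num) (by norm_num)).1 hm
      omega
  refine ⟨fun j hj hsj => ?_, fun h1 => ?_, fun h0 => ?_⟩
  · rw [se_cycle_getElem V hsj, Nat.add_comm, Function.iterate_add_apply, ← se_cycle_getElem V hs, hds]
    exact tp_walk_run V K x (ι.sinkLegs - 1) hrail j hj
  · have hext := se_cycle_exterior ι V hadm h (t := s - 1) (by omega)
    refine s3_dsucc_injective V _ _ hext.1 hext.2 hpV.1 hpV.2 ?_
    rw [hpred, se_cycle_getElem V (by omega), ← Function.iterate_succ_apply' (dsucc V), Nat.succ_eq_add_one,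
      Nat.sub_add_cancel h1, ← se_cycle_getElem V hs, hds]
  · subst h0
    have hP := length_cycle_pos ι V hadm h
    have hext := se_cycle_exterior ι V hadm h (t := (cycle V d₀).length - 1) (by omega)
    refine s3_dsucc_injective V _ _ hext.1 hext.2 hpV.1 hpV.2 ?_
    rw [hpred, se_dsucc_last ι V hadm h]
    have h00 : (cycle V d₀)[0] = d₀ := by simp [cycle]
    rw [← h00, hds]

/-- A frame chart of radius `L + 1` at `x` restricts to the radius-`2` chart at every rail point
`x + j • dir (K+1)`, `-1 ≤ j ≤ L - 1`. [folklore] -/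
theorem se_chart_at {V : Finset (ℤ × ℤ)} {x : ℤ × ℤ} {K : Fin 4} {L : ℕ}
    (hch : ∀ s t : ℤ, -3 ≤ s → s ≤ (L : ℤ) + 1 → -2 ≤ t → t ≤ 2 →
      (x + s • dir (K + 1) + t • dir K ∈ V ↔ t ≤ 0))
    (j : ℤ) (hj : -1 ≤ j) (hj' : j ≤ (L : ℤ) - 1) :
    ∀ s t : ℤ, -2 ≤ s → s ≤ 2 → -2 ≤ t → t ≤ 2 →
      (x + j • dir (K + 1) + s • dir (K + 1) + t • dir K ∈ V ↔ t ≤ 0) := by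
  intro s t hs1 hs2 ht1 ht2
  have e : x + j • dir (K + 1) + s • dir (K + 1) + t • dir K = x + (j + s) • dir (K + 1) + t • dir K := by module
  rw [e]
  exact hch _ _ (by omega) (by omega) ht1 ht2

include hadm h hst in
/-- **Active darts are rail darts.** If the level changes at dart `t` (under the flatness clause),
then `ds[t] = (c, K)` for a rail point `c` with radius-`2` frame charts at `c` and at the previous
rail point `c - dir (K+1)`, and the cyclically previous dart is `(c - dir (K+1), K)`. [folklore] -/
theorem se_active_rail
    (hflat : ∀ x ∈ insert ι.sink ι.source, ∃ d : ℤ × ℤ, (d = (1, 0) ∨ d = (-1, 0) ∨ d = (0, 1) ∨ d = (0, -1)) ∧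
      ∀ v : ℤ × ℤ, (v.1 - x.1) ^ 2 + (v.2 - x.2) ^ 2 ≤ ((ι.sinkLegs : ℤ) + 3) ^ 2 →
        (v ∈ V ↔ 0 ≤ (v.1 - x.1) * d.1 + (v.2 - x.2) * d.2))
    {t : ℕ} (ht : t < (cycle V d₀).length) (hact : (st (t + 1)).level ≠ (st t).level) :
    ∃ (c : ℤ × ℤ) (K : Fin 4),
      (∀ s t : ℤ, -2 ≤ s → s ≤ 2 → -2 ≤ t → t ≤ 2 → (c + s • dir (K + 1) + t • dir K ∈ V ↔ t ≤ 0)) ∧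
      (∀ s t : ℤ, -2 ≤ s → s ≤ 2 → -2 ≤ t → t ≤ 2 →
        (c - dir (K + 1) + s • dir (K + 1) + t • dir K ∈ V ↔ t ≤ 0)) ∧
      (cycle V d₀)[t] = (c, K) ∧
      (∀ (h1 : 1 ≤ t), (cycle V d₀)[t - 1] = (c - dir (K + 1), K)) ∧
      (t = 0 → (cycle V d₀)[(cycle V d₀).length - 1]'(by omega) = (c - dir (K + 1), K)) := by
  obtain ⟨s, hst', hts, hne⟩ := se_active_footprint ι V hadm hst ht hact
  obtain ⟨⟨L', σ⟩, hso⟩ := Option.ne_none_iff_exists'.1 hne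
  obtain ⟨hx, hout, -, -, -⟩ := se_startAt_some ι V hadm h hso
  obtain ⟨K, hout', hch⟩ := se_chart_of_mem ι V hadm hflat hx
  have hds : (cycle V d₀)[s] = (((cycle V d₀)[s]).1, K) := Option.some.inj (hout.symm.trans hout')
  set x := ((cycle V d₀)[s]).1 with hx_def
  obtain ⟨hrun, hpred1, hpred0⟩ := se_run ι V hadm h hch (by omega) hds
  have hL := sinkLegs_pos ι V hadm
  set j := t - s with hj_def
  have htj : t = s + j := by omega
  refine ⟨x + (j : ℤ) • dir (K + 1), K, se_chart_at hch j (by omega) (by omega), ?_, ?_, ?_, ?_⟩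
  · have e : x + (j : ℤ) • dir (K + 1) - dir (K + 1) = x + ((j : ℤ) - 1) • dir (K + 1) := by module
    rw [e]
    exact se_chart_at hch ((j : ℤ) - 1) (by omega) (by omega)
  · have := hrun j (by omega) (by omega)
    simp only [← htj] at this
    exact this
  · intro h1
    rcases Nat.eq_zero_or_pos j with hj0 | hjpos
    · have hts : t = s := by omega
      have e : x + (j : ℤ) • dir (K + 1) - dir (K + 1) = x - dir (K + 1) := by rw [hj0]; simp
      rw [e]
      simp only [hts]
      exact hpred1 (by omega)
    · have := hrun (j - 1) (by omega) (by omega)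
      have e : x + (j : ℤ) • dir (K + 1) - dir (K + 1) = x + ((j - 1 : ℕ) : ℤ) • dir (K + 1) := by
        rw [Nat.cast_sub hjpos]; module
      rw [e, ← this]
      congr 1
      omega
  · intro h0
    have hs0 : s = 0 := by omega
    have hj0 : j = 0 := by omega
    have e : x + (j : ℤ) • dir (K + 1) - dir (K + 1) = x - dir (K + 1) := by rw [hj0]; simp
    rw [e]
    exact hpred0 hs0

/-! ### The two phases of the level profile -/

include hadm h in
/-- Insertions starting after the sink's dart are sources (sign `-1`, at least one leg). [folklore] -/
theorem se_startAt_sgn_neg {t : ℕ} (ht1 : 1 ≤ t) (ht : t < (cycle V d₀).length) {L' : ℕ} {σ : ℤ}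
    (hs : ι.startAt V (cycle V d₀)[t] = some (L', σ)) : σ = -1 ∧ 1 ≤ L' := by
  obtain ⟨-, -, hL', -, hσ⟩ := se_startAt_some ι V hadm h hs
  rcases hσ with ⟨-, hd⟩ | ⟨hσ, -⟩
  · exfalso
    have h00 : (cycle V d₀)[0]'(by omega) = d₀ := by simp [cycle]
    have := se_cycle_index_inj ι V hadm h ht (by omega : 0 < _) (hd.trans h00.symm)
    omega
  · exact ⟨hσ, hL'⟩

include hadm h hst in
/-- **The two phases of the level profile.** There is an index `1 ≤ T₀ ≤ P` (the end of the sink's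
footprint) with level `0` such that the level increases strictly at every dart before `T₀` and is
non-increasing from `T₀` on. [folklore] -/
theorem se_phases : ∃ T₀ : ℕ, 1 ≤ T₀ ∧ T₀ ≤ (cycle V d₀).length ∧ (st T₀).level = 0 ∧
    (∀ t, t < T₀ → (st t).level < (st (t + 1)).level) ∧
    (∀ t, T₀ ≤ t → t < (cycle V d₀).length → (st (t + 1)).level ≤ (st t).level) := by
  classical
  have hP := length_cycle_pos ι V hadm h
  obtain ⟨-, -, hfp⟩ := st_final ι V hadm h hst
  have hex : ∃ n, 1 ≤ n ∧ (st n).pending = 0 := ⟨_, hP, hfp⟩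
  obtain ⟨hT1, hTp⟩ := Nat.find_spec hex
  have hTmin : ∀ n, 1 ≤ n → n < Nat.find hex → (st n).pending ≠ 0 := fun n hn hnT hp =>
    Nat.find_min hex hnT ⟨hn, hp⟩
  have hTP : Nat.find hex ≤ (cycle V d₀).length := Nat.find_min' hex ⟨hP, hfp⟩
  set T₀ := Nat.find hex with hT₀
  obtain ⟨hsgn1, -, hlev1, -⟩ := st_one ι V hadm h hst
  have hnone : ∀ t (_ : 1 ≤ t) (_ : t < T₀), ι.startAt V ((cycle V d₀)[t]'(by omega)) = none := by
    intro t ht1 htT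
    by_contra hne
    exact hTmin t ht1 htT (st_pending_of_startAt ι V hadm h hst (by omega) hne)
  have hup : ∀ t, 1 ≤ t → t ≤ T₀ → (st t).sgn = 1 ∧ (st t).level + (st t).sgn * (st t).pending = 0 := by
    intro t ht1 htT
    induction t with
    | zero => omega
    | succ t ih =>
      rcases Nat.eq_zero_or_pos t with rfl | htpos
      · exact ⟨hsgn1, st_potential_one ι V hadm h hst⟩
      · obtain ⟨ihs, ihp⟩ := ih htpos (by omega)
        rw [st_succ ι V hst (t := t) (by omega), hnone t htpos (by omega)]
        obtain ⟨-, hsg, -, hpot⟩ := se_step_none_of_pending (st t) (hTmin t htpos (by omega))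
        rw [hpot, hsg]
        exact ⟨ihs, ihp⟩
  have hlev0 : (st T₀).level = 0 := by
    have := (hup T₀ hT1 le_rfl).2
    rw [hTp] at this
    simpa using this
  have hdown : ∀ t, T₀ ≤ t → t ≤ (cycle V d₀).length → (st t).pending = 0 ∨ (st t).sgn = -1 := by
    intro t hTt htP
    induction t, hTt using Nat.le_induction with
    | base => exact Or.inl hTp
    | succ t hTt ih =>
      have ih := ih (by omega)
      rw [st_succ ι V hst (t := t) (by omega)]
      rcases hso : ι.startAt V (cycle V d₀)[t] with _ | ⟨L', σ⟩
      · by_cases h0 : (st t).pending = 0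
        · left; rw [step_none_of_pending _ h0]; exact h0
        · right
          rw [(se_step_none_of_pending (st t) h0).2.1]
          exact ih.resolve_left h0
      · obtain ⟨hσ, hL'⟩ := se_startAt_sgn_neg ι V hadm h (le_trans hT1 hTt) (by omega) hso
        right
        rw [(se_step_some (st t) L' σ hL').2, hσ]
  refine ⟨T₀, hT1, hTP, hlev0, fun t htT => ?_, fun t hTt htP => ?_⟩
  · rcases Nat.eq_zero_or_pos t with ht0 | htpos
    · subst ht0
      have hmod : ι.sinkLegs % 2 < 2 := Nat.mod_lt _ two_pos
      rw [hlev1, hst 0]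
      simp only [List.take_zero, List.foldl_nil, LegInsertionData.init]
      omega
    · rw [st_succ ι V hst (t := t) (by omega), hnone t htpos htT]
      obtain ⟨hl, -, -, -⟩ := se_step_none_of_pending (st t) (hTmin t htpos htT)
      have hs := (hup t htpos htT.le).1
      rcases hl with hl | hl <;> rw [hl, hs] <;> omega
  · rw [st_succ ι V hst (t := t) htP]
    rcases hso : ι.startAt V (cycle V d₀)[t] with _ | ⟨L', σ⟩
    · by_cases h0 : (st t).pending = 0
      · rw [step_none_of_pending _ h0]
      · obtain ⟨hl, -, -, -⟩ := se_step_none_of_pending (st t) h0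
        have hs : (st t).sgn = -1 := (hdown t hTt htP.le).resolve_left h0
        rcases hl with hl | hl <;> rw [hl, hs] <;> omega
    · obtain ⟨hσ, hL'⟩ := se_startAt_sgn_neg ι V hadm h (le_trans hT1 hTt) htP hso
      obtain ⟨hl, -⟩ := se_step_some (st t) L' σ hL'
      rcases hl with hl | hl <;> rw [hl, hσ] <;> omega

end Admissible

/-! ### Registered one-line form -/

/-- **Sub-goal `s14_strandEnds_activeRail`** (registered on stmt-CriticalPhenomena-14132): for an
admissible leg insertion with flat insertion points, every dart of the collar walk where the level
changes is a rail dart `(c, K)` of a flat stretch (radius-`2` frame charts at `c` and at the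
previous rail point, previous dart `(c - dir (K+1), K)`), and the level profile has two phases:
strictly up to level `0` at the end `T₀` of the sink's footprint, non-increasing afterwards.
[folklore] -/
theorem s14_strandEnds_activeRail : ∀ (ι : Literature.Probability.LatticeModels.CollarLegModel.LegInsertionData) (V : Finset (ℤ × ℤ)) (d₀ : Literature.Probability.LatticeModels.CollarLegModel.Dart) (st : ℕ → Literature.Probability.LatticeModels.CollarLegModel.WalkState), ι.IsAdmissible V → Literature.Probability.LatticeModels.CollarLegModel.outDart V ι.sink = some d₀ → (∀ t, st t = List.foldl (fun s d ↦ s.step (ι.startAt V d)) ι.init ((Literature.Probability.LatticeModels.CollarLegModel.cycle V d₀).take t)) → (∀ x ∈ insert ι.sink ι.source, ∃ d : ℤ × ℤ, (d = (1, 0) ∨ d = (-1, 0) ∨ d = (0, 1) ∨ d = (0, -1)) ∧ ∀ v : ℤ × ℤ, (v.1 - x.1) ^ 2 + (v.2 - x.2) ^ 2 ≤ ((ι.sinkLegs : ℤ) + 3) ^ 2 → (v ∈ V ↔ 0 ≤ (v.1 - x.1) * d.1 + (v.2 - x.2) * d.2)) → (∀ (t : ℕ) (ht : t < (Literature.Probability.LatticeModels.CollarLegModel.cycle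 V d₀).length), (st (t + 1)).level ≠ (st t).level → ∃ (c : ℤ × ℤ) (K : Fin 4), (∀ s t : ℤ, -2 ≤ s → s ≤ 2 → -2 ≤ t → t ≤ 2 → (c + s • Literature.Probability.LatticeModels.CollarLegModel.dir (K + 1) + t • Literature.Probability.LatticeModels.CollarLegModel.dir K ∈ V ↔ t ≤ 0)) ∧ (∀ s t : ℤ, -2 ≤ s → s ≤ 2 → -2 ≤ t → t ≤ 2 → (c - Literature.Probability.LatticeModels.CollarLegModel.dir (K + 1) + s • Literature.Probability.LatticeModels.CollarLegModel.dir (K + 1) + t • Literature.Probability.LatticeModels.CollarLegModel.dir K ∈ V ↔ t ≤ 0)) ∧ (Literature.Probability.LatticeModels.CollarLegModel.cycle V d₀)[t] = (c, K) ∧ (∀ (h1 : 1 ≤ t), (Literature.Probability.LatticeModels.CollarLegModel.cycle V d₀)[t - 1] = (c - Literature.Probability.LatticeModels.CollarLegModel.dir (K + 1), K)) ∧ (t = 0 → (Literature.Probability.LatticeModels.CollarLegModel.cycle V d₀)[(Literature.Probability.LatticeModels.CollarLegModel.cycle V d₀).length - 1] = (c - Literature.Probability.LatticeModels.CollarLegModel.dir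 (K + 1), K))) ∧ (∃ T₀ : ℕ, 1 ≤ T₀ ∧ T₀ ≤ (Literature.Probability.LatticeModels.CollarLegModel.cycle V d₀).length ∧ (st T₀).level = 0 ∧ (∀ t, t < T₀ → (st t).level < (st (t + 1)).level) ∧ (∀ t, T₀ ≤ t → t < (Literature.Probability.LatticeModels.CollarLegModel.cycle V d₀).length → (st (t + 1)).level ≤ (st t).level)) :=
  fun ι V _ _ hadm h hst hflat => ⟨fun _ ht hact => se_active_rail ι V hadm h hst hflat ht hact, se_phases ι V hadm h hst⟩

end Summit.CriticalPhenomena.CardyFormulaZ2.Cruxes.BoundaryDefectGaussianR.RainbowMonomialsInExcursionKernels
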